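import Summits.BirchSwinnertonDyer.BirchSwinnertonDyer.Theorems.KolyvaginDepthDoorDepthTableKuriharaDecisive709a1
import Summits.BirchSwinnertonDyer.BirchSwinnertonDyer.Theorems.KolyvaginDepthDoorDepthTableKuriharaDecisivePair709a1
import HarnessLib

/-!
# Route `KolyvaginDepthDoor`, crux `KolyvaginDepthSupplyKN` (stmt-BirchSwinnertonDyer-22820) —
# DEPTH TABLE v22, ROW `709a1` @ `p = 5`: «ONE ANTICYCLOTOMIC BIT ⟺ TWO PRESCRIBED CYCLOTOMIC RESIDUES» — the row read with NO
# record claim as a hypothesis: bit ⟺ (unit `δ̃_{7171}(E)` ∧ unit `δ̃_{ℓ★}(T₀)`), both Kurihara numbers at PRESCRIBED levels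

Helper file of the lead prover of line `levelone` (kdd-p1 g26; `--supports stmt-BirchSwinnertonDyer-22820 --as helper`);
it closes nothing and BSD is NOT proved by it.

v19–v21 (`twistKuriharaBit_iff_unit_71`) read this row as «bit ⟺ unit at the decisive prime of the twist» GRANTED the E-side record claim `hδE`
(the tree record `cert_709a1` @ level `7171`) as a hypothesis. v22 (`sha_inf_torsionBy_eq_bot_iff_kuriharaClaim_5_7171`, file
`…KuriharaDecisivePair709a1`: «`Ш(E)[5] = 0` ⟺ unit `δ̃_{7171}(E)`», kernel localisation matrix) lets the claim move to the
right-hand side: the depth-table bit at `(E, p, K)` holds IF AND ONLY IF BOTH prescribed residues are units — the E-residue at the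
recorded pair, the twist residue at the decisive prime. (⟹: the exact row gives `Ш(E)[5] = 0`, v22 turns it into the E-unit, v19–v21
give the twist unit; ⟸: v19–v21 with `hδE :=` the E-unit.) CONDITIONAL on the named facts displayed (now including `hSakR`); per curve;
nothing class-wide; BSD is NOT proved by any of this.

References: [Sakamoto2022pSelmer] Lemma 4.4, Lemma 4.6 (1), Thm. 1.2, Thm. 1.5; [Kim2022StructureSelmer] Thm. 1.11; [WZhang2014] Lemma 8.4 (1);
[GrossLMS1991] Prop. 3.7 (2); [CremonaAlgorithms1997] Table 1 (709a1).
-/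

set_option linter.dupNamespace false

noncomputable section

open scoped Classical NumberField

namespace Summit.BirchSwinnertonDyer.BirchSwinnertonDyer.Theorems.KolyvaginDepthDoor

open Literature.NumberTheory.EllipticCurves Literature.NumberTheory.EllipticCurves.ModularForms
  WeierstrassCurve NumberField IsDedekindDomain
open Summit.BirchSwinnertonDyer.BirchSwinnertonDyer.Theorems
open Summit.BirchSwinnertonDyer.BirchSwinnertonDyer.Rank2Observatory

namespace C709a1

/-- **ROW `709a1` @ `5`, v22: bit ⟺ (unit `δ̃_{7171}(E)` ∧ unit at the decisive prime of the twist)** — for every imaginary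
quadratic `K` of the row's discriminant: «some frame, some Kolyvagin PRIME `ℓ`, some Kolyvagin–Heegner datum of conductor `ℓ` with
`c_1(ℓ) ≠ 0`» IF AND ONLY IF «every admissible datum of `E` has a unit mod-`5` Kurihara number AT `7171`» AND «every admissible datum
of the twist model has a unit at the decisive prime» — `twistKuriharaBit_iff_unit_71` with its hypothesis `hδE` discharged BOTH WAYS by
`sha_inf_torsionBy_eq_bot_iff_kuriharaClaim_5_7171` and the exact row. No record claim is assumed. CONDITIONAL on the named facts;
per curve; BSD is not proved by it. [cite: Sakamoto2022pSelmer, Lemma 4.4, Lemma 4.6 (1)] [cite: Kim2022StructureSelmer, Thm. 1.11]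
[cite: WZhang2014, Lemma 8.4 (1) (p. 236)] [cite: GrossLMS1991, Prop. 3.7 (2)] [cite: CremonaAlgorithms1997, Table 1 (709a1)] -/
theorem kolyvaginPrime_iff_kuriharaUnits_5_7171
    (h372 : GrossLMS1991.prop37_2_frobeniusCongruence)
    (h84 : Literature.NumberTheory.EllipticCurves.WZhang2014_lemma84_exists_minimal_kolyvaginClass_one_selmerCard)
    (hKim : Kim2022_card_selmerGroup_le_pow_of_kuriharaNumber_ne_zero)
    (hSak1 : Sakamoto2022_card_selmerGroup_eq_pow_of_isDeltaMinimal)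
    (hSak2 : Sakamoto2022_exists_cyclicLevel_kuriharaNumber_ne_zero)
    (hSak3 : Literature.NumberTheory.EllipticCurves.Sakamoto2022_kuriharaNumber_prime_ne_zero_of_localNondivisible)
    (hnf : exists_isNewformOf) (hMaz : mazur_not_dvd_maninConstant_of_odd)
    (K : Type) [Field K] [NumberField K] (hK : IsImaginaryQuadratic K) (hD : NumberField.discr K = -7)
    (hSakR : Sakamoto2022_kuriharaNumber_ne_zero_of_localizationInjective) :
    haveI := isElliptic_c709a1; haveI := isGloballyMinimal_c709a1;
    haveI : NeZero (((⟨0, -1, 1, -2, 0⟩ : WeierstrassCurve ℤ).map (Int.castRingHom ℚ)).conductorNorm ℤ) := neZero_conductorNorm_of_isElliptic _;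
    haveI := minTwist7_isElliptic; haveI := minTwist7_isGloballyMinimal;
    haveI : NeZero (((⟨0, 1, 1, -114, 130⟩ : WeierstrassCurve ℤ).map (Int.castRingHom ℚ)).conductorNorm ℤ) := neZero_conductorNorm_of_isElliptic _;
    haveI := Fact.mk (by norm_num : Nat.Prime 5);
    (∃ (Dt : ModularParametrizationData ((⟨0, -1, 1, -2, 0⟩ : WeierstrassCurve ℤ).map (Int.castRingHom ℚ)) (((⟨0, -1, 1, -2, 0⟩ : WeierstrassCurve ℤ).map (Int.castRingHom ℚ)).conductorNorm ℤ)) (β : ℤ)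
      (ι : K →+* ℂ) (ℓ : ℕ) (d : KolyvaginHeegnerData Dt β ι ℓ),
      ℓ.Prime ∧ Zhang2014.IsKolyvaginPrime (((⟨0, -1, 1, -2, 0⟩ : WeierstrassCurve ℤ).map (Int.castRingHom ℚ)).conductorNorm ℤ) ((⟨0, -1, 1, -2, 0⟩ : WeierstrassCurve ℤ).map (Int.castRingHom ℚ)) K 5 ℓ ∧
        d.kolyvaginClass (p := 5) (by norm_num) 1 ≠ 0)
      ↔
    ((haveI := isElliptic_c709a1; haveI := isGloballyMinimal_c709a1;
      haveI : NeZero (((⟨0, -1, 1, -2, 0⟩ : WeierstrassCurve ℤ).map (Int.castRingHom ℚ)).conductorNorm ℤ) := neZero_conductorNorm_of_isElliptic _;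
      haveI := Fact.mk (by norm_num : Nat.Prime 5);
      ∀ (D : ModularParametrizationData ((⟨0, -1, 1, -2, 0⟩ : WeierstrassCurve ℤ).map (Int.castRingHom ℚ)) (((⟨0, -1, 1, -2, 0⟩ : WeierstrassCurve ℤ).map (Int.castRingHom ℚ)).conductorNorm ℤ)), ¬ ((5 : ℕ) : ℤ) ∣ D.maninConstant →
        (∃ u : ℚ, ‖(u : ℚ_[5])‖ = 1 ∧ ((⟨0, -1, 1, -2, 0⟩ : WeierstrassCurve ℤ).map (Int.castRingHom ℚ)).realPeriodRat = u * plusPeriod D.f) →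
        ∃ ψ : (ℓ : ℕ) → (ZMod ℓ)ˣ →* Multiplicative (ZMod 5),
          (∀ ℓ ∈ (7171 : ℕ).primeFactors, Function.Surjective (ψ ℓ)) ∧ kuriharaNumber D.f 5 7171 ψ ≠ 0) ∧
    (∀ (D : ModularParametrizationData ((⟨0, 1, 1, -114, 130⟩ : WeierstrassCurve ℤ).map (Int.castRingHom ℚ))
          (((⟨0, 1, 1, -114, 130⟩ : WeierstrassCurve ℤ).map (Int.castRingHom ℚ)).conductorNorm ℤ)),
        ¬ ((5 : ℕ) : ℤ) ∣ D.maninConstant →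
        (∃ u : ℚ, ‖(u : ℚ_[5])‖ = 1 ∧
          ((⟨0, 1, 1, -114, 130⟩ : WeierstrassCurve ℤ).map (Int.castRingHom ℚ)).realPeriodRat = u * plusPeriod D.f) →
        ∃ ψ : (q : ℕ) → (ZMod q)ˣ →* Multiplicative (ZMod 5),
          (∀ q ∈ (71 : ℕ).primeFactors, Function.Surjective (ψ q)) ∧ kuriharaNumber D.f 5 71 ψ ≠ 0) )
 := by
  constructor
  · intro hbit
    have hsha := ((exactRowZhang_5_neg7_rankFree h372 h84 K hK hD).mp hbit).1
    have hE := (sha_inf_torsionBy_eq_bot_iff_kuriharaClaim_5_7171 hKim hnf hMaz hSakR).mp hsha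
    exact ⟨hE, (twistKuriharaBit_iff_unit_71 h372 h84 hKim hSak1 hSak2 hSak3 hnf hMaz K hK hD hE).mp hbit⟩
  · rintro ⟨hE, hT⟩
    exact (twistKuriharaBit_iff_unit_71 h372 h84 hKim hSak1 hSak2 hSak3 hnf hMaz K hK hD hE).mpr hT

end C709a1

end Summit.BirchSwinnertonDyer.BirchSwinnertonDyer.Theorems.KolyvaginDepthDoor

end
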